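import Summits.CriticalPhenomena.PercolationContinuityZ3.Theorems.Transplant.SkelPhiSeedSlabQ
import HarnessLib

/-!
# N1 (the `{±1}` node), LEVEL 1, kit adapter file N-K4a: THE INWARD STEM AND THE WIRED PATH OF A CONTACT under quasi-steps of cost `N` — after
# the inward quasi-step and the tangential quasi-path at depth `1` (`SkelPhiSeedSlabQ`), a straight inward quasi-walk of `d` more unit moves
# (depth `1 + k`, tangential coordinate fixed); the union of all link sets is the contact's WIRED PATH, `G`-connected from the inner neighbour,
# with exact planar footprints, ending at the STEM END `t₁` (depth `1 + d`) about which the base-chart apron (`SkelPhiApron`) is built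

builds on p205010 (kernel theorem, internal audit signed; external expert review pending) — nothing in this file uses p205010; nothing here is a
claim about the open node `SamePDropOfSkeletonNeg`.
Lane `prim-bschramm`, seat `prim-bschramm-p1` (gen 11; apron-kit design KIT-APRON-N1, lane INBOX 2026-08-21 13:56Z); helper file
(`--supports stmt-CriticalPhenomena-4575 --as helper`).
WHY.  In D″ (one chart) the deep centre was an independent column vertex and the path's last vertex met the slab cylinder through (κ); with two
charts (window map `ψ`, base chart `φ`) and unbounded fibres the wired body must CONTAIN the path's end, so the path itself is continued inward to
the depth at which the apron is anchored.
* §1 `stemPtQ` (`= walkQ i₀ (−σ₀) p_K k`), `stemPtQ_zero`, `ψ_stemPtQ`, `stemPtQ_link`, `stemPtQ_mem_graphBall`;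
* §2 `stemFinQ` (`⋃_{k<d} linkFinQ (stemPt k) (stemPt (k+1))`), `stemPtQ_mem_stemFinQ`, `ψ_of_mem_stemFinQ`, `stemFinQ_subset_graphBall`, `card_stemFinQ_le`;
* §3 **`wireFinQ`** (`= pathFinQ ∪ stemFinQ`), `left_mem_wireFinQ`, `stemPtQ_mem_wireFinQ`, `ψ_of_mem_wireFinQ`, `wireFinQ_subset_graphBall`, `card_wireFinQ_le`,
  **`pathIn_of_wireFinQ_subset`**.
[cite: KozmaNitzan2024, §4 Lemma 10, p. 19 (Step III), p. 21 (v(P) + Λ_M)] [cite: MartineauTassion2017, §4.3]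
-/

open scoped Classical

namespace Summit.CriticalPhenomena.PercolationContinuityZ3.Theorems.Transplant

namespace Skelφ

open Literature.Probability.Percolation Literature.Probability.LatticeModels SimpleGraph KNLevels
open Literature.Probability.Percolation.KozmaNitzan.Cells (oth oth_ne eq_oth_of_ne oth_oth)
open Literature.Barriers.CriticalPhenomena (graphBall graphBall_finite mem_graphBall_self graphBall_mono)
open SkelI (slabPt tanOff tanTgt tanTgt_mem natAbs_tanTgt_sub_le tanSign natAbs_mul_tanSign deepPt)

variable {V : Type} (G : SimpleGraph V) (ψ : V → Site 2)

noncomputable section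

/-! ## §1 The inward stem -/

/-- **The inward stem** of a contact with inner neighbour `y`, exit datum `(i₀, σ₀)`: `k` quasi-steps along `−σ₀ e_{i₀}` from the last vertex `p_K`
of the tangential quasi-path. [this work] -/
def stemPtQ (N : ℕ) (Lo Hi : Site 2) (ℓs M : ℕ) (i₀ : Fin 2) (σ₀ : ℤˣ) (y : V) (k : ℕ) : V :=
  walkQ G ψ N i₀ (-σ₀) (pathPtQ G ψ N Lo Hi ℓs M i₀ y (pathLen ψ Lo Hi ℓs M i₀ y)) k

variable {G ψ}

/-- `stemPt 0 = p_K`. [folklore] -/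
@[simp] theorem stemPtQ_zero (N : ℕ) (Lo Hi : Site 2) (ℓs M : ℕ) (i₀ : Fin 2) (σ₀ : ℤˣ) (y : V) :
    stemPtQ G ψ N Lo Hi ℓs M i₀ σ₀ y 0 = pathPtQ G ψ N Lo Hi ℓs M i₀ y (pathLen ψ Lo Hi ℓs M i₀ y) := rfl

/-- Planar position along the stem: `ψ (stemPt k) = ψ p_K − k σ₀ e_{i₀}` (under `QStepsN`). [folklore] -/
theorem ψ_stemPtQ {N : ℕ} (hq : QStepsN G ψ N) (Lo Hi : Site 2) (ℓs M : ℕ) (i₀ : Fin 2) (σ₀ : ℤˣ) (y : V) (k : ℕ) :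
    ψ (stemPtQ G ψ N Lo Hi ℓs M i₀ σ₀ y k) =
      ψ (pathPtQ G ψ N Lo Hi ℓs M i₀ y (pathLen ψ Lo Hi ℓs M i₀ y)) + Pi.single i₀ ((k : ℤ) * ((-σ₀ : ℤˣ) : ℤ)) := by
  unfold stemPtQ; rw [F_walkQ hq]

/-- The stem's coordinates (box side `≥ 2` in `i₀`, `ψ y` in the box): exit coordinate `slabPt … i₀ − k σ₀`, tangential coordinate `τ`. [folklore] -/
theorem ψ_stemPtQ_coords {N : ℕ} (hq : QStepsN G ψ N) {Lo Hi : Site 2} {ℓs M : ℕ} (i₀ : Fin 2) (hw2 : Lo i₀ + 2 ≤ Hi i₀) (σ₀ : ℤˣ) {y : V}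
    (hy : ψ y ∈ Finset.Icc Lo Hi) (k : ℕ) :
    ψ (stemPtQ G ψ N Lo Hi ℓs M i₀ σ₀ y k) i₀ = slabPt Lo Hi 1 (ψ y) i₀ - (k : ℤ) * (σ₀ : ℤ) ∧
      ψ (stemPtQ G ψ N Lo Hi ℓs M i₀ σ₀ y k) (oth i₀) = tanTgt Lo Hi ℓs M (oth i₀) (ψ y) := by
  rw [ψ_stemPtQ hq]
  refine ⟨?_, ?_⟩
  · rw [Pi.add_apply, Pi.single_eq_same, (ψ_pathPtQ hq i₀ hw2 hy _).1, Units.val_neg]; ring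
  · rw [Pi.add_apply, Pi.single_eq_of_ne (oth_ne i₀), add_zero, ψ_pathPtQ_last hq i₀ hw2 hy]

/-- Consecutive stem vertices are linked. [folklore] -/
theorem stemPtQ_link {N : ℕ} (hq : QStepsN G ψ N) (Lo Hi : Site 2) (ℓs M : ℕ) (i₀ : Fin 2) (σ₀ : ℤˣ) (y : V) (k : ℕ) :
    LinkN G ψ N (stemPtQ G ψ N Lo Hi ℓs M i₀ σ₀ y k) (stemPtQ G ψ N Lo Hi ℓs M i₀ σ₀ y (k + 1)) :=
  walkQ_link hq _ _ _ k

/-- Stem vertices are within graph distance `N(K+1) + N k` of `y`. [folklore] -/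
theorem stemPtQ_mem_graphBall {N : ℕ} (hq : QStepsN G ψ N) {Lo Hi : Site 2} {ℓs M : ℕ} (i₀ : Fin 2) (hw2 : Lo i₀ + 2 ≤ Hi i₀) (σ₀ : ℤˣ) {y : V}
    (hy : ψ y ∈ Finset.Icc Lo Hi) (k : ℕ) :
    stemPtQ G ψ N Lo Hi ℓs M i₀ σ₀ y k ∈ graphBall G y (N * (pathLen ψ Lo Hi ℓs M i₀ y + 1) + N * k) := by
  unfold stemPtQ
  exact BoxProdZ2.mem_graphBall_add G (pathPtQ_mem_graphBall hq (ℓs := ℓs) (M := M) i₀ hw2 hy _) (walkQ_mem_graphBall hq i₀ (-σ₀) _ k)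

/-! ## §2 The stem's link sets -/

section Fin

variable [DecidableEq V]

variable (G ψ) in
/-- **The vertex set of the stem of length `d`**: the link sets of its `d` unit moves. [this work] -/
def stemFinQ (N : ℕ) (Lo Hi : Site 2) (ℓs M : ℕ) (i₀ : Fin 2) (σ₀ : ℤˣ) (y : V) (d : ℕ) : Finset V :=
  (Finset.range d).biUnion fun k => linkFinQ G ψ N (stemPtQ G ψ N Lo Hi ℓs M i₀ σ₀ y k) (stemPtQ G ψ N Lo Hi ℓs M i₀ σ₀ y (k + 1))

/-- Stem vertices `stemPt k`, `1 ≤ k ≤ d`, belong to the stem's vertex set (under `QStepsN`). [folklore] -/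
theorem stemPtQ_mem_stemFinQ {N : ℕ} (hq : QStepsN G ψ N) (Lo Hi : Site 2) (ℓs M : ℕ) (i₀ : Fin 2) (σ₀ : ℤˣ) (y : V) {d k : ℕ} (hk1 : 1 ≤ k)
    (hk : k ≤ d) : stemPtQ G ψ N Lo Hi ℓs M i₀ σ₀ y k ∈ stemFinQ G ψ N Lo Hi ℓs M i₀ σ₀ y d := by
  unfold stemFinQ
  refine Finset.mem_biUnion.2 ⟨k - 1, Finset.mem_range.2 (by omega), ?_⟩
  have e : k - 1 + 1 = k := by omega
  rw [e]
  have h := stemPtQ_link hq Lo Hi ℓs M i₀ σ₀ y (k - 1)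
  rw [e] at h
  exact right_mem_linkFinQ h

/-- `stemPt 0 = p_K` belongs to the stem's vertex set as soon as `1 ≤ d`. [folklore] -/
theorem stemPtQ_zero_mem_stemFinQ (N : ℕ) (Lo Hi : Site 2) (ℓs M : ℕ) (i₀ : Fin 2) (σ₀ : ℤˣ) (y : V) {d : ℕ} (hd : 1 ≤ d) :
    stemPtQ G ψ N Lo Hi ℓs M i₀ σ₀ y 0 ∈ stemFinQ G ψ N Lo Hi ℓs M i₀ σ₀ y d := by
  unfold stemFinQ
  exact Finset.mem_biUnion.2 ⟨0, Finset.mem_range.2 (by omega), left_mem_linkFinQ _ _ _⟩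

/-- **Footprint of the stem's vertex set**: every vertex is at `ψ (stemPt k)` for some `k ≤ d`. [folklore] -/
theorem ψ_of_mem_stemFinQ {N : ℕ} {Lo Hi : Site 2} {ℓs M : ℕ} {i₀ : Fin 2} {σ₀ : ℤˣ} {y v : V} {d : ℕ}
    (hv : v ∈ stemFinQ G ψ N Lo Hi ℓs M i₀ σ₀ y d) : ∃ k, k ≤ d ∧ ψ v = ψ (stemPtQ G ψ N Lo Hi ℓs M i₀ σ₀ y k) := by
  unfold stemFinQ at hv
  obtain ⟨k, hk, hu⟩ := Finset.mem_biUnion.1 hv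
  rw [Finset.mem_range] at hk
  rcases F_of_mem_linkFinQ' hu with h' | h'
  · exact ⟨k, hk.le, h'⟩
  · exact ⟨k + 1, hk, by rw [h']⟩

/-- The stem's vertex set lies in `B_G(y, N(K+1) + N d)` (under `QStepsN`, box side `≥ 2`, `ψ y` in the box). [folklore] -/
theorem stemFinQ_subset_graphBall {N : ℕ} (hq : QStepsN G ψ N) {Lo Hi : Site 2} {ℓs M : ℕ} (i₀ : Fin 2) (hw2 : Lo i₀ + 2 ≤ Hi i₀) (σ₀ : ℤˣ)
    {y : V} (hy : ψ y ∈ Finset.Icc Lo Hi) (d : ℕ) :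
    ∀ v ∈ stemFinQ G ψ N Lo Hi ℓs M i₀ σ₀ y d, v ∈ graphBall G y (N * (pathLen ψ Lo Hi ℓs M i₀ y + 1) + N * d) := by
  intro v hv
  unfold stemFinQ at hv
  obtain ⟨k, hk, hu⟩ := Finset.mem_biUnion.1 hv
  rw [Finset.mem_range] at hk
  have h1 := BoxProdZ2.mem_graphBall_add G (stemPtQ_mem_graphBall hq (ℓs := ℓs) (M := M) i₀ hw2 σ₀ hy k) (linkFinQ_subset_graphBall _ _ _ v hu)
  refine graphBall_mono G y ?_ h1
  have := Nat.mul_le_mul_left N (show k + 1 ≤ d from hk)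
  rw [Nat.mul_succ] at this
  omega

/-- The stem's vertex set has at most `(N+1) d` vertices. [folklore] -/
theorem card_stemFinQ_le (N : ℕ) (Lo Hi : Site 2) (ℓs M : ℕ) (i₀ : Fin 2) (σ₀ : ℤˣ) (y : V) (d : ℕ) :
    (stemFinQ G ψ N Lo Hi ℓs M i₀ σ₀ y d).card ≤ (N + 1) * d := by
  unfold stemFinQ
  refine Finset.card_biUnion_le.trans ?_
  calc ∑ k ∈ Finset.range d, (linkFinQ G ψ N (stemPtQ G ψ N Lo Hi ℓs M i₀ σ₀ y k) (stemPtQ G ψ N Lo Hi ℓs M i₀ σ₀ y (k + 1))).card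
      ≤ ∑ _k ∈ Finset.range d, (N + 1) := Finset.sum_le_sum fun k _ => card_linkFinQ_le _ _ _
    _ = (N + 1) * d := by rw [Finset.sum_const, Finset.card_range, smul_eq_mul, mul_comm]

/-! ## §3 The wired path of a contact: tangential path ∪ stem -/

variable (G ψ) in
/-- **The wired path** of a contact: the tangential quasi-path's vertex set together with the stem's. [this work] -/
def wireFinQ (N : ℕ) (Lo Hi : Site 2) (ℓs M : ℕ) (i₀ : Fin 2) (σ₀ : ℤˣ) (y : V) (d : ℕ) : Finset V :=
  pathFinQ G ψ N Lo Hi ℓs M i₀ y ∪ stemFinQ G ψ N Lo Hi ℓs M i₀ σ₀ y d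

/-- The inner neighbour belongs to the wired path. [folklore] -/
theorem left_mem_wireFinQ (N : ℕ) (Lo Hi : Site 2) (ℓs M : ℕ) (i₀ : Fin 2) (σ₀ : ℤˣ) (y : V) (d : ℕ) :
    y ∈ wireFinQ G ψ N Lo Hi ℓs M i₀ σ₀ y d :=
  Finset.mem_union_left _ (left_mem_pathFinQ _ _ _ _ _ _ _)

/-- Every stem vertex `stemPt k`, `k ≤ d`, belongs to the wired path (under `QStepsN`, box side `≥ 2`, `ψ y` in the box). [folklore] -/
theorem stemPtQ_mem_wireFinQ {N : ℕ} (hq : QStepsN G ψ N) {Lo Hi : Site 2} {ℓs M : ℕ} (i₀ : Fin 2) (hw2 : Lo i₀ + 2 ≤ Hi i₀) (σ₀ : ℤˣ)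
    {y : V} (hy : ψ y ∈ Finset.Icc Lo Hi) {d k : ℕ} (hk : k ≤ d) :
    stemPtQ G ψ N Lo Hi ℓs M i₀ σ₀ y k ∈ wireFinQ G ψ N Lo Hi ℓs M i₀ σ₀ y d := by
  unfold wireFinQ
  rcases Nat.eq_zero_or_pos k with rfl | hk0
  · exact Finset.mem_union_left _ (by rw [stemPtQ_zero]; exact pathPtQ_mem_pathFinQ hq i₀ hw2 hy le_rfl)
  · exact Finset.mem_union_right _ (stemPtQ_mem_stemFinQ hq Lo Hi ℓs M i₀ σ₀ y hk0 hk)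

/-- The stem end `t₁ = stemPt d` belongs to the wired path. [folklore] -/
theorem stemEnd_mem_wireFinQ {N : ℕ} (hq : QStepsN G ψ N) {Lo Hi : Site 2} {ℓs M : ℕ} (i₀ : Fin 2) (hw2 : Lo i₀ + 2 ≤ Hi i₀) (σ₀ : ℤˣ)
    {y : V} (hy : ψ y ∈ Finset.Icc Lo Hi) (d : ℕ) :
    stemPtQ G ψ N Lo Hi ℓs M i₀ σ₀ y d ∈ wireFinQ G ψ N Lo Hi ℓs M i₀ σ₀ y d :=
  stemPtQ_mem_wireFinQ hq i₀ hw2 σ₀ hy le_rfl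

/-- **Footprint of the wired path**: every vertex is at `ψ y`, at `ψ p_k` (`k ≤ K`) or at `ψ (stemPt k)` (`k ≤ d`). [folklore] -/
theorem ψ_of_mem_wireFinQ {N : ℕ} {Lo Hi : Site 2} {ℓs M : ℕ} {i₀ : Fin 2} {σ₀ : ℤˣ} {y v : V} {d : ℕ}
    (hv : v ∈ wireFinQ G ψ N Lo Hi ℓs M i₀ σ₀ y d) :
    ψ v = ψ y ∨ (∃ k, k ≤ pathLen ψ Lo Hi ℓs M i₀ y ∧ ψ v = ψ (pathPtQ G ψ N Lo Hi ℓs M i₀ y k)) ∨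
      ∃ k, k ≤ d ∧ ψ v = ψ (stemPtQ G ψ N Lo Hi ℓs M i₀ σ₀ y k) := by
  unfold wireFinQ at hv
  rcases Finset.mem_union.1 hv with h | h
  · rcases ψ_of_mem_pathFinQ h with h' | h'
    · exact Or.inl h'
    · exact Or.inr (Or.inl h')
  · exact Or.inr (Or.inr (ψ_of_mem_stemFinQ h))

/-- The wired path lies in `B_G(y, N K + 2N + N d)` (`K = pathLen`). [folklore] -/
theorem wireFinQ_subset_graphBall {N : ℕ} (hq : QStepsN G ψ N) {Lo Hi : Site 2} {ℓs M : ℕ} (i₀ : Fin 2) (hw2 : Lo i₀ + 2 ≤ Hi i₀) (σ₀ : ℤˣ)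
    {y : V} (hy : ψ y ∈ Finset.Icc Lo Hi) (d : ℕ) :
    ∀ v ∈ wireFinQ G ψ N Lo Hi ℓs M i₀ σ₀ y d, v ∈ graphBall G y (N * pathLen ψ Lo Hi ℓs M i₀ y + 2 * N + N * d) := by
  intro v hv
  unfold wireFinQ at hv
  rcases Finset.mem_union.1 hv with h | h
  · exact graphBall_mono G y (by omega) (pathFinQ_subset_graphBall hq i₀ hw2 hy v h)
  · refine graphBall_mono G y ?_ (stemFinQ_subset_graphBall hq i₀ hw2 σ₀ hy d v h)
    rw [Nat.mul_succ]; omega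

/-- The wired path has at most `(N+1)(K+1) + (N+1) d` vertices. [folklore] -/
theorem card_wireFinQ_le (N : ℕ) (Lo Hi : Site 2) (ℓs M : ℕ) (i₀ : Fin 2) (σ₀ : ℤˣ) (y : V) (d : ℕ) :
    (wireFinQ G ψ N Lo Hi ℓs M i₀ σ₀ y d).card ≤ (N + 1) * (pathLen ψ Lo Hi ℓs M i₀ y + 1) + (N + 1) * d := by
  unfold wireFinQ
  exact (Finset.card_union_le _ _).trans (Nat.add_le_add (card_pathFinQ_le _ _ _ _ _ _ _) (card_stemFinQ_le _ _ _ _ _ _ _ _ _))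

/-- **The wired path is `G`-connected from `y` inside any set containing it** (under `QStepsN`, box side `≥ 2`, `ψ y` in the box). [folklore] -/
theorem pathIn_of_wireFinQ_subset {N : ℕ} (hq : QStepsN G ψ N) {Lo Hi : Site 2} {ℓs M : ℕ} (i₀ : Fin 2) (hw2 : Lo i₀ + 2 ≤ Hi i₀) (σ₀ : ℤˣ)
    {y : V} (hy : ψ y ∈ Finset.Icc Lo Hi) {d : ℕ} {A : Set V} (hA : ∀ v ∈ wireFinQ G ψ N Lo Hi ℓs M i₀ σ₀ y d, v ∈ A) :
    ∀ v ∈ wireFinQ G ψ N Lo Hi ℓs M i₀ σ₀ y d, PathIn G A y v := by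
  have hApath : ∀ v ∈ pathFinQ G ψ N Lo Hi ℓs M i₀ y, v ∈ A := fun v hv => hA v (by unfold wireFinQ; exact Finset.mem_union_left _ hv)
  have hAlink : ∀ k, k < d → ∀ u ∈ linkFinQ G ψ N (stemPtQ G ψ N Lo Hi ℓs M i₀ σ₀ y k) (stemPtQ G ψ N Lo Hi ℓs M i₀ σ₀ y (k + 1)), u ∈ A :=
    fun k hk u hu => hA u (by unfold wireFinQ stemFinQ; exact Finset.mem_union_right _ (Finset.mem_biUnion.2 ⟨k, Finset.mem_range.2 hk, hu⟩))
  -- to the stem points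
  have hP : ∀ k, k ≤ d → PathIn G A y (stemPtQ G ψ N Lo Hi ℓs M i₀ σ₀ y k) := by
    intro k hk
    induction k with
    | zero => rw [stemPtQ_zero]; exact pathIn_of_pathFinQ_subset hq i₀ hw2 hy hApath _ (pathPtQ_mem_pathFinQ hq i₀ hw2 hy le_rfl)
    | succ k ih =>
      exact (ih (by omega)).trans
        (pathIn_of_linkFinQ_subset (hAlink k (by omega)) _ (right_mem_linkFinQ (stemPtQ_link hq Lo Hi ℓs M i₀ σ₀ y k)))
  intro v hv
  unfold wireFinQ at hv
  rcases Finset.mem_union.1 hv with h | h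
  · exact pathIn_of_pathFinQ_subset hq i₀ hw2 hy hApath v h
  · unfold stemFinQ at h
    obtain ⟨k, hk, hu⟩ := Finset.mem_biUnion.1 h
    rw [Finset.mem_range] at hk
    exact (hP k hk.le).trans (pathIn_of_linkFinQ_subset (hAlink k hk) v hu)

end Fin

end

end Skelφ

end Summit.CriticalPhenomena.PercolationContinuityZ3.Theorems.Transplant
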